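import Summits.QuantumFields.YangMills.Theorems.BalabanUVNodesN16HolderOfThm4Output
import Summits.QuantumFields.YangMills.Theorems.BalabanUVNodesN16RegimeDefs
import HarnessLib

/-!
# Route «BalabanUVNodes», cluster K4 «SpineRates» — node N16 = NE3: THE RECORD-LEVEL β-KIT, PRINT FORM — the interface slot `PrintSlotHolder c β`
# (n16-e's `PrintSlot c` with the (1.36) Hölder line at exponent `β`), `N16HolderAt` at every bundle pinned in THE END's regime (ONE `(r, Cof)` for every
# `β ≤ 1`), the β-uniform thresholds `radiusOfRecordH` ∕ `constOfRecordH`, the proviso `InEndRegimeH`, and the one-application closers — β = 1 included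

Cell `pub-ymgap`, seat `pub-ymgap-dag-n16-c` (R134 fan-out seat, strategy s1; HUMAN RULING D-0062; chair R424 venue), generation 3, file 15 — module (E1) of
the located item «the Hölder-exponent pin of N16's N05-socket» (`HOME/pub-ymgap-dag-n16-c/LOCATED-N16-HOLDER-PIN.md`; pub-ymgap INBOX DAGN16C-G3-INTENT-2);
over file 13 `…N16HolderOfThm4Output` (`n16_holder_of_thm4TorusAt_print`, p480313) and n16-e's `…N16RegimeDefs` (`PrintSlot`, `InEndRegime`, p… — MIRRORED at
exponent `β`, NOT edited).  DEFINITION lane (3 `def`s + `Iff.rfl`∕`Classical.choose_spec` bookkeeping; 0 sorry).  `--supports stmt-QuantumFields-19908` (helper).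
`bears_on: R4∕N16 · edge N05 → N16`.

WHY.  Under the located repair R-β a `Record11∕12`-keyed home quotes N16's slot and proviso at a PRINTED exponent `β ∈ (2∕3, 1)`.  n16-a's file 14
`N16AtRecord.n16At_of_pinned_thm4TorusAt_print` and n16-e's `N16Regime.PrintSlot ∕ radiusOfRecord ∕ constOfRecord ∕ InEndRegime ∕ n16At_of_inEndRegime_printSlot`
package the column of record bundle-wise at `β = 1`; the thresholds of record are `Classical.choose` of the `β = 1` theorem and say nothing at `β < 1`.  THIS FILE
is the same packaging over the β-column (files 11–14 of this seat): the slot at exponent `β` (§1), the pinned theorem with ONE `(r, Cof)` serving EVERY `β ≤ 1`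
(§2), thresholds CHOSEN from it (§3) — so the H-regime closes the β-slot for every `β ≤ 1` AND, at `β = 1`, n16-e's slot OF RECORD (§4): a planner adopting R-β
re-points `InEndRegime ↦ InEndRegimeH`, `PrintSlot ↦ PrintSlotHolder · β`, `N16At ↦ N16HolderAt · β` by name and nothing else on N16's side; and since the
H-thresholds are chosen MONOTONICALLY against the record's (`min` ∕ `max`), `InEndRegimeH → InEndRegime`: whatever is keyed to the proviso of record stays fed.

WHAT THIS FILE DECLARES: §1 `PrintSlotHolder c β` · `printSlotHolder_iff` · `printSlotHolder_one_iff : PrintSlotHolder c 1 ↔ PrintSlot c`;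
§2 `n16HolderAt_of_pinned_printSlotHolder`; §3 `radiusOfRecordH := min (radiusOfRecord) r′` · `constOfRecordH := max (constOfRecord) Cof′` (MONOTONE choice,
dag-n16-e g4's design word) · `radiusOfRecordH_le` · `constOfRecord_le_constOfRecordH` · `InEndRegimeH` · `inEndRegimeH_iff` · `regimeH_spec` · `radiusOfRecordH_pos` ·
`constOfRecordH_nonneg` · `inEndRegimeH_iff_of_familyL` · ★ THE BRIDGE `inEndRegime_of_inEndRegimeH : InEndRegimeH c → InEndRegime c`; §4 closers
`n16HolderAt_of_inEndRegimeH_printSlotHolder` (`β ≤ 1`) · `n16At_of_inEndRegimeH_printSlot` (β = 1, the slot OF RECORD; `…'` through the bridge) ·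
`s_N16Holder_of_inEndRegimeH_printSlotHolder` · `s_N16_of_inEndRegimeH_printSlot`.
HONEST FRAMING: definitions and bookkeeping; `PrintSlotHolder` is a hypothesis SHAPE ([Balaban1985RegularSpaces] Thm 4 + Prop 3 in the all-torus geometry with
the (1.36) Hölder member AS PRINTED, and [Balaban1985Variational] Thm 1 (8)+(10) TYPE) asserted for no bundle; nothing of Bałaban's proved; **N16 ∕ NE3 NOT
discharged**; the repair's statement edit (R-β ∕ R-Δ ∕ R-min) is the planner's ∕ director's; count-neutral; one finite four-torus at fixed ε — NOT ℝ⁴, NOT infinite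
volume, NOT OS, NOT a mass gap, NOT Clay.
-/

set_option autoImplicit false

open scoped BigOperators Matrix Matrix.Norms.L2Operator
open NormedSpace

namespace Summit.QuantumFields.YangMills.BalabanUVNodes.N16HolderRegime

open Literature.MathematicalPhysics.QuantumFieldTheory.Balaban1983to89
open Literature.MathematicalPhysics.QuantumFieldTheory.Balaban1983to89.T4Continuum (T4Family ULoop)
open B7Prop1Explicit B7Prop2Explicit
open T4AveragingDeficitWall (Ad)
open B7Eq92Concrete (mgauge)
open B8Ineq132 (covDerivFwd)
open B8Eq184Proof (cfgExp)
open B8Eq119TwistedAxial (Restr129)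
open B8Eq133Hypotheses (Reg335Zd)
open B8Eq138LandauZd (covLap IsLandau138)
open B8Thm4TorusAt (torusLam Thm4TorusAt)
open Summit.QuantumFields.BalabanUV.T4Continuum
open MinimalActionRate (sfClass)
open BlockAverageCurrent (curConst)
open NE3RightInverseSupLetters (frameC)
open NE3.LeafIndexSockets (LeafH3sup)
open YMDAG.UVSplit (Datum NE3Carriers RateCarriers RateRecordPred N16At S_N16)
open Summit.QuantumFields.YangMills.BalabanUVNodes.N16HolderDefs (CovRootHolder N16HolderAt S_N16Holder n16HolderAt_one_iff)
open Summit.QuantumFields.YangMills.BalabanUVNodes.N16HolderOfThm4Output (n16_holder_of_thm4TorusAt_print)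
open Summit.QuantumFields.YangMills.BalabanUVNodes.N16Regime (PrintSlot InEndRegime radiusOfRecord constOfRecord radiusOfRecord_pos constOfRecord_nonneg
  n16At_of_inEndRegime_printSlot)

noncomputable section

/-! ## §1 The print-form interface slot at a bundle, at Hölder exponent `β` -/

/-- **THE PRINT-FORM INTERFACE SLOT AT A BUNDLE `c : NE3Carriers N`, HÖLDER MEMBER AT EXPONENT `β`** — n16-e's `N16Regime.PrintSlot c` VERBATIM but for the
(1.36) Hölder line of the concrete conclusion slot, `≤ B_h·(α₀+α₁)·((c.L⁻¹)^k) ^ β` instead of `^ (1 : ℝ)`: for SOME Theorem-4 constants `(c₁, B, B_h)`, leaf letters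
`(b′, c′)`, averaging letter `α` with `c.ε < α`, (3.35) schedule and the four k-free letter lines, [Balaban1985RegularSpaces] THEOREM 4 IN THE ALL-TORUS GEOMETRY at
every level `k ≥ 1` with its conclusion in print's letters ((1.36)₁,₂, (1.38), (1.36)₃ at exponent `β` — printed for `β ≦ β₀ < 1`, p. 82 — and (1.39)₁), AND N07's
`LeafH3sup 4 c.L c.Nper c.ε b′ c′ c.dom`.  `PrintSlotHolder c 1 ↔ PrintSlot c` (below).  A hypothesis SHAPE — asserted for no bundle here.
[cite: Balaban1985RegularSpaces, Thm 4 p.88, (1.36)–(1.38) p.82, (1.39) p.83] -/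
@[folklore]
def PrintSlotHolder {N : ℕ} (c : NE3Carriers N) (β : ℝ) : Prop :=
  ∃ (c₁ B Bh b' c' α Mc C335 : ℝ) (𝒬 : ℕ → Set (Set (Site 4) × ℕ)),
    0 ≤ b' ∧ 0 ≤ c' ∧ 2 ^ 15 * ((4 : ℝ) + 1) ^ 2 * ((4 : ℝ) + 4) ^ 2 * (c.L : ℝ) ^ 2 * b' ≤ 1 ∧
    23040 * (4 : ℝ) ^ 4 * (frameC 4 c.L + 4) ^ 3 * (c' + curConst 4 c.L * b' ^ 2) ≤ 1 ∧
    0 < α ∧ C0 4 * α ≤ 1 / 3 ∧ 2 * α ≤ c2' 4 c.L ∧ 11 * (4 : ℝ) ^ 2 * α ≤ 1 / 6 ∧ α + 11 * (4 : ℝ) ^ 2 * α ≤ c₁ ∧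
    (b' + 226 * (8 * ((4 : ℝ) + 1) * ((4 : ℝ) + 4)) ^ 2 * b' ^ 2) < α ∧ 4 * ((4 : ℝ) - 1) * (c' + curConst 4 c.L * b' ^ 2) < α ∧
    0 ≤ Mc ∧ (Mc + 1) * (b' + 226 * (8 * ((4 : ℝ) + 1) * ((4 : ℝ) + 4)) ^ 2 * b' ^ 2) ≤ 1 / 2 ∧
    (∀ k, ∀ q ∈ 𝒬 k, q.2 ≤ k ∧ ∃ y : Site 4, ∀ z ∈ q.1, (l1 (z - y) : ℝ) ≤ Mc * (c.L : ℝ) ^ q.2) ∧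
    2 * (Mc + 1) * (b' + 226 * (8 * ((4 : ℝ) + 1) * ((4 : ℝ) + 4)) ^ 2 * b' ^ 2) + 2 * Mc * (2 * (c' + curConst 4 c.L * b' ^ 2)) +
      4 * Mc * (1 + 2 * Mc) * (b' + 226 * (8 * ((4 : ℝ) + 1) * ((4 : ℝ) + 4)) ^ 2 * b' ^ 2) ^ 2 < C335 ∧
    c.ε < α ∧ B * (α + 11 * (4 : ℝ) ^ 2 * α) ≤ c.Λ₁ ∧
    B * (α + 11 * (4 : ℝ) ^ 2 * α) + 2 * (b' + 226 * (8 * ((4 : ℝ) + 1) * ((4 : ℝ) + 4)) ^ 2 * b' ^ 2) * c.Λ₁ ≤ c.Λ₁ ∧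
    B * (α + 11 * (4 : ℝ) ^ 2 * α) + 16 * (b' + 226 * (8 * ((4 : ℝ) + 1) * ((4 : ℝ) + 4)) ^ 2 * b' ^ 2) * (B * (α + 11 * (4 : ℝ) ^ 2 * α)) ≤ c.Λ₁ ∧
    Bh * (α + 11 * (4 : ℝ) ^ 2 * α) + 8 * (b' + 226 * (8 * ((4 : ℝ) + 1) * ((4 : ℝ) + 4)) ^ 2 * b' ^ 2) * (B * (α + 11 * (4 : ℝ) ^ 2 * α)) ≤ c.Λ₂' ∧
    (∀ k, 1 ≤ k → Thm4TorusAt c.L k (((c.Nper * c.L ^ k : ℕ) : ℤ)) (((c.L : ℝ) ^ k)⁻¹) c₁ (unitaryUnits (Matrix (Fin N) (Fin N) ℂ))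
      (Reg335Zd (((c.L : ℝ) ^ k)⁻¹) c.L (𝒬 k) C335) (Restr129 c.L k (torusLam k))
      (fun (α₀ α₁ : ℝ) (U₀ U' : Site 4 → Fin 4 → (Matrix (Fin N) (Fin N) ℂ)ˣ) (u : Site 4 → (Matrix (Fin N) (Fin N) ℂ)ˣ) =>
        ∃ A : Site 4 → Fin 4 → Matrix (Fin N) (Fin N) ℂ,
          (∀ x μ, IsSelfAdjoint (A x μ)) ∧ (∀ (x : Site 4) (κ μ : Fin 4), A (x + (((c.Nper * c.L ^ k : ℕ) : ℤ)) • e κ) μ = A x μ) ∧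
          mgauge U₀ u (cfgExp (((c.L : ℝ) ^ k)⁻¹) A) = U' ∧
          (∀ x μ, ‖A x μ‖ ≤ B * (α₀ + α₁)) ∧
          (∀ (μ : Fin 4) (x : Site 4) (κ : Fin 4), ‖covDerivFwd (((c.L : ℝ) ^ k)⁻¹) U₀ μ (fun z => A z κ) x‖ ≤ B * (α₀ + α₁)) ∧
          IsLandau138 c.L k (((c.L : ℝ) ^ k)⁻¹) Set.univ (torusLam k) U₀ A ∧
          (∀ (μ : Fin 4) (y : Site 4) (κ : Fin 4),
            ‖Ad (U₀ y μ) (covDerivFwd (((c.L : ℝ) ^ k)⁻¹) U₀ μ (fun z => A z κ) (y + e μ)) - covDerivFwd (((c.L : ℝ) ^ k)⁻¹) U₀ μ (fun z => A z κ) y‖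
              ≤ Bh * (α₀ + α₁) * (((c.L : ℝ)⁻¹) ^ k) ^ β) ∧
          (∀ (x : Site 4) (κ : Fin 4), ‖covLap (((c.L : ℝ) ^ k)⁻¹) U₀ (fun z => A z κ) x‖ ≤ B * (α₀ + α₁)))) ∧
    LeafH3sup 4 c.L c.Nper c.ε b' c' c.dom

/-- `PrintSlotHolder c β` unfolded (`Iff.rfl`) is its displayed body; in particular **at `β = 1` it IS n16-e's slot of record**: `PrintSlotHolder c 1 ↔ PrintSlot c`
(`Iff.rfl` — the Hölder line `^ β` at `β := 1` is literally `^ (1 : ℝ)`). [folklore] -/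
theorem printSlotHolder_one_iff {N : ℕ} (c : NE3Carriers N) : PrintSlotHolder c 1 ↔ PrintSlot c :=
  Iff.rfl

/-! ## §2 `N16HolderAt` at every bundle pinned in THE END's regime carrying the β-slot — ONE `(r, Cof)` for every `β ≤ 1` -/

section Pinned

variable {N : ℕ} [NeZero N]

/-- **THE β-SLOT CLOSES `N16HolderAt` AT EVERY BUNDLE PINNED IN THE END's REGIME, UNIFORMLY IN `β ≤ 1`** (block factor `L ≥ 2`, period `Nper ≥ 1`) — n16-a's
`N16AtRecord.n16At_of_pinned_thm4TorusAt_print` with `1 ↦ β`: there are `r > 0` and `Cof : ℝ → ℝ` (`0 ≤ Cof g` for `g > 0`) — THE END's radius and constant, functions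
of `(L, Nper, N[, g])` ONLY, chosen BEFORE `β` and before Theorem 4's constants — such that every bundle `c` with `c.L = L`, `c.Nper = Nper`, `0 < c.g`, `0 < c.ε ≤ r`,
`0 ≤ c.Λ₁ ≤ r`, `0 ≤ c.b ≤ c.ε∕2`, `Cof c.g ≤ c.C` satisfies `PrintSlotHolder c β → N16HolderAt c β` for EVERY `β ≤ 1`.  File 13's `n16_holder_of_thm4TorusAt_print`
packaged bundle-wise (`choose`; constant raised by `CovRootHolder.mono`). [folklore] -/
theorem n16HolderAt_of_pinned_printSlotHolder {L Nper : ℕ} (hL : 2 ≤ L) (hN : 1 ≤ Nper) :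
    ∃ r : ℝ, 0 < r ∧ ∃ Cof : ℝ → ℝ, (∀ g, 0 < g → 0 ≤ Cof g) ∧
      ∀ c : NE3Carriers N, c.L = L → c.Nper = Nper → 0 < c.g → 0 < c.ε → c.ε ≤ r → 0 ≤ c.Λ₁ → c.Λ₁ ≤ r → 0 ≤ c.b → c.b ≤ c.ε / 2 →
        Cof c.g ≤ c.C → ∀ ⦃β : ℝ⦄, β ≤ 1 → PrintSlotHolder c β → N16HolderAt c β := by
  haveI : Nonempty (Fin N) := ⟨⟨0, Nat.pos_of_ne_zero (NeZero.ne N)⟩⟩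
  obtain ⟨r, hr0, hr⟩ := n16_holder_of_thm4TorusAt_print (n := Fin N) hL hN
  choose Cof hCof0 hCof using hr
  refine ⟨r, hr0, fun g => if h : 0 < g then Cof h else 0, fun g hg => by simp only [dif_pos hg]; exact hCof0 hg, ?_⟩
  rintro ⟨cL, cN, ε, b, g, C, Λ₁, Λ₂', dom⟩ rfl rfl hg hε hεr hs₁ hs₁r hb hbh hC β hβ
    ⟨c₁, B, Bh, b', c', α, Mc, C335, 𝒬, hb', hc', hRb, hcF, hα, hA3, hA2, hAs, hAc, hb'α, hc'α, hMc, hMcα, h𝒬, hC335, hεα, hss, hgrad, hℓ, hhol, hT4, h3⟩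
  simp only [dif_pos hg] at hC
  exact (hCof hg c₁ B Bh hb' hc' hRb hcF hα hA3 hA2 hAs hAc hb'α hc'α hMc hMcα 𝒬 h𝒬 hC335 hε hεr hεα hs₁ hs₁r hb hbh hss hgrad hℓ hhol hβ hT4 h3).mono
    hC le_rfl le_rfl

end Pinned

/-! ## §3 THE END's β-uniform thresholds CHOSEN as functions of `(L, Nper)`; the proviso -/

section Thresholds

variable (N : ℕ) [NeZero N]

/-- **THE END's CLASS∕HÖLDER RADIUS, β-UNIFORM AND MONOTONE CHOICE `r_H(L, Nper, N) := min (radiusOfRecord N L Nper) r′`**, `r′` the `r > 0` of §2 at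
`(L, Nper)` CHOSEN (`Classical.choose`); `0` off the side conditions `2 ≤ L ∧ 1 ≤ Nper`.  Taking the `min` with n16-e's radius OF RECORD (dag-n16-e g4's design
word, INBOX ANSWER-N16C (E)) makes the H-regime IMPLY the regime of record (`inEndRegime_of_inEndRegimeH`), so every `InEndRegime`-keyed theorem in the tree is
fed from it by one application, while `r_H ≤ r′` keeps §2's β-closers. [folklore] -/
def radiusOfRecordH (L Nper : ℕ) : ℝ :=
  if h : 2 ≤ L ∧ 1 ≤ Nper then min (radiusOfRecord N L Nper) (Classical.choose (n16HolderAt_of_pinned_printSlotHolder (N := N) h.1 h.2)) else 0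

/-- **THE END's CONSTANT, β-UNIFORM AND MONOTONE CHOICE `Cof_H(L, Nper, N, g) := max (constOfRecord N L Nper g) (Cof′ g)`**, `Cof′` the `Cof` of §2 at
`(L, Nper)` CHOSEN; `0` off the side conditions.  `constOfRecord ≤ Cof_H` (the bridge) and `Cof′ ≤ Cof_H` (§2's closers). [folklore] -/
def constOfRecordH (L Nper : ℕ) (g : ℝ) : ℝ :=
  if h : 2 ≤ L ∧ 1 ≤ Nper then
    max (constOfRecord N L Nper g) (Classical.choose (Classical.choose_spec (n16HolderAt_of_pinned_printSlotHolder (N := N) h.1 h.2)).2 g)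
  else 0

/-- `r_H ≤` n16-e's radius of record (on the side conditions). [folklore] -/
theorem radiusOfRecordH_le {L Nper : ℕ} (hL : 2 ≤ L) (hN : 1 ≤ Nper) : radiusOfRecordH N L Nper ≤ radiusOfRecord N L Nper := by
  simp only [radiusOfRecordH, dif_pos (And.intro hL hN)]
  exact min_le_left _ _

/-- n16-e's constant of record `≤ Cof_H` (on the side conditions). [folklore] -/
theorem constOfRecord_le_constOfRecordH {L Nper : ℕ} (hL : 2 ≤ L) (hN : 1 ≤ Nper) (g : ℝ) :
    constOfRecord N L Nper g ≤ constOfRecordH N L Nper g := by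
  simp only [constOfRecordH, dif_pos (And.intro hL hN)]
  exact le_max_left _ _

variable {N}

/-- **THE END's REGIME AT A BUNDLE, β-UNIFORM THRESHOLDS** — n16-e's proviso `N16Regime.InEndRegime c` VERBATIM with `radiusOfRecord ↦ radiusOfRecordH`,
`constOfRecord ↦ constOfRecordH`: block factor `≥ 2`, period `≥ 1`, positive coupling letter, class radius and gradient letter inside `radiusOfRecordH`, regularity
`0 ≤ b ≤ ε∕2`, constant at least `constOfRecordH`. [folklore] -/
@[folklore]
def InEndRegimeH (c : NE3Carriers N) : Prop :=
  2 ≤ c.L ∧ 1 ≤ c.Nper ∧ 0 < c.g ∧ 0 < c.ε ∧ c.ε ≤ radiusOfRecordH N c.L c.Nper ∧ 0 ≤ c.Λ₁ ∧ c.Λ₁ ≤ radiusOfRecordH N c.L c.Nper ∧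
    0 ≤ c.b ∧ c.b ≤ c.ε / 2 ∧ constOfRecordH N c.L c.Nper c.g ≤ c.C

/-- `InEndRegimeH c` unfolded (`Iff.rfl`). [folklore] -/
theorem inEndRegimeH_iff (c : NE3Carriers N) :
    InEndRegimeH c ↔
      2 ≤ c.L ∧ 1 ≤ c.Nper ∧ 0 < c.g ∧ 0 < c.ε ∧ c.ε ≤ radiusOfRecordH N c.L c.Nper ∧ 0 ≤ c.Λ₁ ∧ c.Λ₁ ≤ radiusOfRecordH N c.L c.Nper ∧
        0 ≤ c.b ∧ c.b ≤ c.ε / 2 ∧ constOfRecordH N c.L c.Nper c.g ≤ c.C :=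
  Iff.rfl

/-- **THE CHOSEN PACKAGE** (`2 ≤ L`, `1 ≤ Nper`): `radiusOfRecordH N L Nper > 0`, `constOfRecordH N L Nper g ≥ 0` for `g > 0`, and every bundle `c` with `c.L = L`,
`c.Nper = Nper` in THE END's regime at these thresholds carrying `PrintSlotHolder c β`, `β ≤ 1`, satisfies `N16HolderAt c β` — `Classical.choose_spec` of §2
through `min ≤ r′`, `Cof′ ≤ max`; `radiusOfRecord_pos` for the sign of the `min`. [folklore] -/
theorem regimeH_spec {L Nper : ℕ} (hL : 2 ≤ L) (hN : 1 ≤ Nper) :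
    0 < radiusOfRecordH N L Nper ∧ (∀ g : ℝ, 0 < g → 0 ≤ constOfRecordH N L Nper g) ∧
      ∀ c : NE3Carriers N, c.L = L → c.Nper = Nper → 0 < c.g → 0 < c.ε → c.ε ≤ radiusOfRecordH N L Nper → 0 ≤ c.Λ₁ →
        c.Λ₁ ≤ radiusOfRecordH N L Nper → 0 ≤ c.b → c.b ≤ c.ε / 2 → constOfRecordH N L Nper c.g ≤ c.C →
        ∀ ⦃β : ℝ⦄, β ≤ 1 → PrintSlotHolder c β → N16HolderAt c β := by
  have hspec := Classical.choose_spec (n16HolderAt_of_pinned_printSlotHolder (N := N) hL hN)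
  have hCof := Classical.choose_spec hspec.2
  simp only [radiusOfRecordH, constOfRecordH, dif_pos (And.intro hL hN)]
  refine ⟨lt_min (radiusOfRecord_pos (N := N) hL hN) hspec.1, fun g hg => (hCof.1 g hg).trans (le_max_right _ _), ?_⟩
  intro c h1 h2 hg hε hεr hs₁ hs₁r hb hbh hC β hβ hslot
  exact hCof.2 c h1 h2 hg hε (hεr.trans (min_le_right _ _)) hs₁ (hs₁r.trans (min_le_right _ _)) hb hbh ((le_max_right _ _).trans hC) hβ hslot

/-- `radiusOfRecordH N L Nper > 0` on the side conditions. [folklore] -/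
theorem radiusOfRecordH_pos {L Nper : ℕ} (hL : 2 ≤ L) (hN : 1 ≤ Nper) : 0 < radiusOfRecordH N L Nper :=
  (regimeH_spec (N := N) hL hN).1

/-- `constOfRecordH N L Nper g ≥ 0` for `g > 0` on the side conditions. [folklore] -/
theorem constOfRecordH_nonneg {L Nper : ℕ} (hL : 2 ≤ L) (hN : 1 ≤ Nper) {g : ℝ} (hg : 0 < g) : 0 ≤ constOfRecordH N L Nper g :=
  (regimeH_spec (N := N) hL hN).2.1 g hg

/-- **THE PROVISO WITH THE BLOCK FACTOR KEYED TO THE FAMILY** (`HistoryFlow.two_le_L`: every four-torus family has `L ≥ 2`): for a bundle with `c.L = F.L` the first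
clause of `InEndRegimeH c` is the family's (n16-e's `inEndRegime_iff_of_familyL` verbatim at the H-thresholds). [folklore] -/
theorem inEndRegimeH_iff_of_familyL {F : T4Family} {c : NE3Carriers N} (hL : c.L = F.L) :
    InEndRegimeH c ↔
      1 ≤ c.Nper ∧ 0 < c.g ∧ 0 < c.ε ∧ c.ε ≤ radiusOfRecordH N F.L c.Nper ∧ 0 ≤ c.Λ₁ ∧ c.Λ₁ ≤ radiusOfRecordH N F.L c.Nper ∧
        0 ≤ c.b ∧ c.b ≤ c.ε / 2 ∧ constOfRecordH N F.L c.Nper c.g ≤ c.C := by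
  rw [inEndRegimeH_iff, hL]
  exact ⟨fun h => h.2, fun h => ⟨HistoryFlow.two_le_L F, h⟩⟩

/-- **THE BRIDGE — `InEndRegimeH c → InEndRegime c`** (dag-n16-e g4's design word): the β-uniform regime IMPLIES n16-e's regime OF RECORD (`r_H ≤ radiusOfRecord`,
`constOfRecord ≤ Cof_H`), so EVERY `InEndRegime`-keyed theorem in the tree (n16-e's files 1–14, n21-d's `inEndRegime_ofRecord_endLettersN21W`, the N14∕N17∕N18
readers of the proviso) is fed from the H-regime by ONE application — no `β = 1` twins anywhere. [folklore] -/
theorem inEndRegime_of_inEndRegimeH {c : NE3Carriers N} (h : InEndRegimeH c) : InEndRegime c := by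
  obtain ⟨hL, hN, hg, hε, hεr, hs₁, hs₁r, hb, hbh, hC⟩ := h
  have hr := radiusOfRecordH_le (N := N) hL hN
  exact ⟨hL, hN, hg, hε, hεr.trans hr, hs₁, hs₁r.trans hr, hb, hbh, (constOfRecord_le_constOfRecordH (N := N) hL hN c.g).trans hC⟩

end Thresholds

/-! ## §4 The one-application closers — at exponent `β ≤ 1`, and at the exponent of record `β = 1` -/

section Closers

variable {N : ℕ} [NeZero N]

/-- **THE ONE-APPLICATION CLOSER AT EXPONENT `β` — `InEndRegimeH c → PrintSlotHolder c β → N16HolderAt c β`** (`β ≤ 1`): a bundle in THE END's β-uniform regime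
carrying the print-form β-slot satisfies the β-analogue of N16's record decl.  What a `Record11∕12`-keyed home's NE3 bundle needs under R-β: its PROVISO
(`InEndRegimeH`) and its CONTENT (`PrintSlotHolder · β` = N05's Theorem 4 at the bundle's pairs with the Hölder member as PRINTED + N07's `LeafH3sup`). [folklore] -/
theorem n16HolderAt_of_inEndRegimeH_printSlotHolder {c : NE3Carriers N} (hreg : InEndRegimeH c) {β : ℝ} (hβ : β ≤ 1)
    (hslot : PrintSlotHolder c β) : N16HolderAt c β := by
  obtain ⟨hL, hN, hg, hε, hεr, hs₁, hs₁r, hb, hbh, hC⟩ := hreg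
  exact (regimeH_spec (N := N) hL hN).2.2 c rfl rfl hg hε hεr hs₁ hs₁r hb hbh hC hβ hslot

/-- **… AND AT THE EXPONENT OF RECORD — `InEndRegimeH c → PrintSlot c → N16At c`**: the β-uniform regime ALSO closes n16-e's slot OF RECORD to N16's decl OF
RECORD (`β = 1`: `printSlotHolder_one_iff`, `n16HolderAt_one_iff`).  So re-pointing a home's proviso `InEndRegime ↦ InEndRegimeH` loses nothing at `β = 1`. [folklore] -/
theorem n16At_of_inEndRegimeH_printSlot {c : NE3Carriers N} (hreg : InEndRegimeH c) (hslot : PrintSlot c) : N16At c :=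
  (n16HolderAt_one_iff c).mp (n16HolderAt_of_inEndRegimeH_printSlotHolder hreg le_rfl ((printSlotHolder_one_iff c).mpr hslot))

/-- … the same through THE BRIDGE and n16-e's closer OF RECORD (`n16At_of_inEndRegime_printSlot ∘ inEndRegime_of_inEndRegimeH`) — the two roads agree. [folklore] -/
theorem n16At_of_inEndRegimeH_printSlot' {c : NE3Carriers N} (hreg : InEndRegimeH c) (hslot : PrintSlot c) : N16At c :=
  n16At_of_inEndRegime_printSlot (inEndRegime_of_inEndRegimeH hreg) hslot

/-- **`S_N16Holder β RRec` FOR EVERY RATE-RECORD PREDICATE WHOSE BUNDLES ARE IN THE β-UNIFORM REGIME AND CARRY THE β-SLOT** (`β ≤ 1`; `RRec`-generic; one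
application per home) — the β-analogue of n16-e's `s_N16_of_inEndRegime_printSlot`. [folklore] -/
theorem s_N16Holder_of_inEndRegimeH_printSlotHolder (RRec : RateRecordPred N) {β : ℝ} (hβ : β ≤ 1)
    (h : ∀ (F : T4Family) (D : Datum F N) (g₀ : ℕ → ℝ) (os : List (ULoop F)) (R : RateCarriers N), RRec F D g₀ os R →
      InEndRegimeH R.ne3 ∧ PrintSlotHolder R.ne3 β) :
    S_N16Holder β RRec :=
  fun F D g₀ os R hR => n16HolderAt_of_inEndRegimeH_printSlotHolder (h F D g₀ os R hR).1 hβ (h F D g₀ os R hR).2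

/-- **`S_N16 RRec` (THE STUB OF RECORD) FROM THE β-UNIFORM REGIME AND THE SLOT OF RECORD** (`RRec`-generic) — n16-e's `s_N16_of_inEndRegime_printSlot` at the
H-thresholds. [folklore] -/
theorem s_N16_of_inEndRegimeH_printSlot (RRec : RateRecordPred N)
    (h : ∀ (F : T4Family) (D : Datum F N) (g₀ : ℕ → ℝ) (os : List (ULoop F)) (R : RateCarriers N), RRec F D g₀ os R →
      InEndRegimeH R.ne3 ∧ PrintSlot R.ne3) :
    S_N16 RRec :=
  fun F D g₀ os R hR => n16At_of_inEndRegimeH_printSlot (h F D g₀ os R hR).1 (h F D g₀ os R hR).2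

end Closers

end

end Summit.QuantumFields.YangMills.BalabanUVNodes.N16HolderRegime
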